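import Summits.CriticalPhenomena.PercolationContinuityZ3.Theses.PercThresholdOne
import Literature.Probability.Percolation.AnchoredProfileVanishing

/-!
# Route `PercThresholdOne`, item `StationaryWeavingVanishingProfile` (stmt-CriticalPhenomena-5262)

GENERALISED CERF–DEMBIN: for every translation-invariant probability measure `ν` on bond configurations
of `ℤ³` which is a.s. WEAVING (all half-space clusters finite), `ν`-a.s. for every `c > 0` and `N` there
are `n ≥ N` and a valid `K ∋ 0` with `|K| ≤ n³` and `n |∂°K| ≤ c |K|`. The measure-free core of
Cerf–Dembin's proof of Thm 1.2 (arXiv:1903.08065 §2: exploration balls, growth induction on the bad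
event, exit of the open edge boundary of the box cluster through `∂ⁱⁿΛ(n)`) is imported from
`Literature.Probability.Percolation.AnchoredProfileVanishing` (`CerfDembinVanishing.badSet`, `boxCluster`,
`boundaryCount`, `lt_card_boxCluster_inter_innerBoundary`, `halfSpaceReach`). Proved here, for a GENERAL
stationary law: `ν(x ∈ 𝒞'(Λ(n))) ≤ Σ_{i,s} ν(σ_{i,s}⁻¹ A_n)` for `x ∈ ∂ⁱⁿΛ(n)` using ONLY translation
invariance (the signed permutation `σ_{i,s}` exchanging axes `i`, `0` stays inside the event); each
`ν(σ⁻¹ A_n) → 0` by continuity from above since `⋂_n σ⁻¹ A_n ⊆ {0 ↔ ∞ via σ⁻¹ℍ}`, null by WEAVE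
(`σ⁻¹ℍ ∈ {{0 ≤ z_i}, {z_i ≤ 0}}`); Markov as in (eq1)–(eq2). No independence, FKG, reflection or
rotation invariance of `ν` is used.
-/

namespace Summit.CriticalPhenomena.PercolationContinuityZ3.Theorems

namespace StationaryWeaving

open MeasureTheory Filter
open Literature.Probability.Percolation Literature.Probability.LatticeModels
open Literature.Probability.Percolation.CerfDembinVanishing
open scoped ENNReal Topology

variable {d : ℕ}

/-! ## Translations of configurations as relabellings -/

/-- The translation `ξ ↦ {e | e + a ∈ ξ}` of bond configurations used in the route statement is the
relabelling along the shift by `-a` (`BondConfig.relabel (sym2Equiv (Site.shift (-a)))`). [folklore] -/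
theorem shiftPreimage_eq_relabel (a : Site d) :
    (fun ξ : BondConfig (Site d) => Sym2.map (· + a) ⁻¹' ξ) =
      ⇑(BondConfig.relabel (sym2Equiv (Site.shift (-a)))) := by
  funext ξ
  ext z
  rw [Set.mem_preimage, BondConfig.mem_relabel_iff, sym2Equiv_symm, sym2Equiv_apply]
  have h : (⇑(Site.shift (-a)).symm : Site d → Site d) = (· + a) := by
    funext x
    rw [Site.shift_symm_apply, sub_neg_eq_add]
  rw [h]

/-- Relabelling along a composite bijection is the composite of the relabellings. [folklore] -/
theorem relabel_trans_apply (e₁ e₂ : Site d ≃ Site d) (ω : BondConfig (Site d)) :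
    BondConfig.relabel (sym2Equiv (e₁.trans e₂)) ω =
      BondConfig.relabel (sym2Equiv e₂) (BondConfig.relabel (sym2Equiv e₁) ω) := by
  ext z
  simp only [BondConfig.mem_relabel_iff, sym2Equiv_symm, sym2Equiv_apply, Sym2.map_map]
  rfl

/-! ## A boundary site joined to `0` inside the box: translation, then a signed permutation -/

/-- **Transport of `{x ∈ 𝒞'(Λ(n))}` to the half-space event.** For `x ∈ ∂ⁱⁿΛ(n)` (`x_i = ∓ n`)
there is a sign `s` such that, with `σ = σ_{i,s} : y ↦ (j ↦ s · y (swap i 0 j))`, the event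
`{x ∈ 𝒞'(Λ(n))}` lies in the translate by `x` of `σ⁻¹ A_n`, `A_n = {0 ↔ height ≥ n in ℍ}`: `y ↦ σ (y - x)`
maps `x` to `0`, `Λ(n)` into `ℍ`, `0` to height `n` (Cerf–Dembin §2, "symmetry of the lattice", split
into translation and rotation). [cite: CerfDembin2020, §2 ((eq1), symmetry of the lattice)] -/
theorem setOf_mem_boxCluster_subset [NeZero d] {n : ℕ} {x : Site d}
    (hx : x ∈ innerBoundary (zdGraph d) (box d n)) :
    ∃ (i : Fin d) (s : ℤˣ), {ω : BondConfig (Site d) | x ∈ boxCluster n ω} ⊆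
      BondConfig.relabel (sym2Equiv (Site.shift (-x))) ⁻¹'
        (BondConfig.relabel (sym2Equiv (zdSignedPermIso (Equiv.swap i 0) fun _ => s).toEquiv) ⁻¹'
          halfSpaceReach d n) := by
  obtain ⟨i, hi⟩ := exists_eq_of_mem_innerBoundary_box hx
  -- the sign of the reflection
  obtain ⟨s, hs0, hsbox⟩ : ∃ s : ℤˣ, (s : ℤ) * (0 - x i) = n ∧
      ∀ y ∈ box d n, 0 ≤ (s : ℤ) * (y i - x i) := by
    by_cases hxi : x i = (n : ℤ)
    · refine ⟨-1, by rw [hxi]; simp, fun y hy => ?_⟩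
      have := (mem_box.1 hy i).2
      rw [hxi]; push_cast; linarith
    · have hxi' : x i = -(n : ℤ) := hi.resolve_left hxi
      refine ⟨1, by rw [hxi']; simp, fun y hy => ?_⟩
      have := (mem_box.1 hy i).1
      rw [hxi']; push_cast; linarith
  refine ⟨i, s, ?_⟩
  -- the automorphism `ψ y = σ (y - x)`
  set π : Equiv.Perm (Fin d) := Equiv.swap i 0 with hπ
  set ψ : zdGraph d ≃g zdGraph d := (zdShiftIso (-x)).trans (zdSignedPermIso π fun _ => s) with hψ
  set e : Site d ≃ Site d := ψ.toEquiv with he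
  have he_apply : ∀ y, e y = Site.signedPerm π (fun _ => s) (y + -x) := fun y => rfl
  have he0 : ∀ y, e y 0 = (s : ℤ) * (y i - x i) := fun y => by
    rw [he_apply, Site.signedPerm_apply, hπ, Equiv.symm_swap, Equiv.swap_apply_right]
    simp [sub_eq_add_neg]
  have hex : e x = 0 := by rw [he_apply, add_neg_cancel, Site.signedPerm_zero]
  have hadj : ∀ u v, (zdGraph d).Adj (e u) (e v) ↔ (zdGraph d).Adj u v := fun u v => ψ.map_rel_iff'
  have hK : ∀ u v, (withinGraph (zdGraph d) (e '' ↑(box d n))).Adj (e u) (e v) ↔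
      (withinGraph (zdGraph d) ↑(box d n)).Adj u v := fun u v => by
    simp only [withinGraph_adj, e.injective.mem_set_image, hadj u v]
  have himg : e '' (↑(box d n) : Set (Site d)) ⊆ halfSpace d := by
    rintro _ ⟨y, hy, rfl⟩
    change 0 ≤ e y 0
    rw [he0]
    exact hsbox y hy
  -- the inclusion of events, for the composite relabelling
  have hsub : {ω | x ∈ boxCluster n ω} ⊆
      BondConfig.relabel (sym2Equiv e) ⁻¹' halfSpaceReach d n := by
    intro ω hω
    have hxω : x ∈ openClusterIn (withinGraph (zdGraph d) ↑(box d n)) ω 0 := mem_boxCluster_iff.1 hω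
    have h0 : (0 : Site d) ∈ openClusterIn (withinGraph (zdGraph d) ↑(box d n)) ω x := by
      rw [openClusterIn_eq_of_mem hxω]
      exact self_mem_openClusterIn _ ω 0
    have hrel := openClusterIn_relabel e hK ω x
    have hmem : e 0 ∈ openClusterIn (withinGraph (zdGraph d) (e '' ↑(box d n)))
        (BondConfig.relabel (sym2Equiv e) ω) 0 := by
      have h := Set.mem_image_of_mem e h0
      rwa [← hrel, hex] at h
    refine ⟨e 0, openClusterIn_mono_graph (withinGraph_mono _ himg) _ 0 hmem, ?_⟩
    rw [he0]
    exact hs0.ge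
  -- split the composite relabelling into the shift and the signed permutation
  intro ω hω
  have h1 : BondConfig.relabel (sym2Equiv e) ω ∈ halfSpaceReach d n := hsub hω
  rw [Set.mem_preimage, Set.mem_preimage, ← relabel_trans_apply]
  exact h1

/-- **`ν(x ∈ 𝒞'(Λ(n))) ≤ Σ_{i,s} ν(σ_{i,s}⁻¹ A_n)` for a translation-invariant `ν`** and
`x ∈ ∂ⁱⁿΛ(n)` (the stationary replacement for Cerf–Dembin's (eq1) "by symmetry of the lattice",
which for `P_p` gives `P_p(x ∈ 𝒞') ≤ P_p(A_n)`). [cite: CerfDembin2020, §2 (eq1)] -/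
theorem measure_setOf_mem_boxCluster_le [NeZero d] (ν : Measure (BondConfig (Site d)))
    (hν : ∀ (a : Site d) (A : Set (BondConfig (Site d))), MeasurableSet A →
      ν ((fun ξ => Sym2.map (· + a) ⁻¹' ξ) ⁻¹' A) = ν A)
    {n : ℕ} {x : Site d} (hx : x ∈ innerBoundary (zdGraph d) (box d n)) :
    ν {ω | x ∈ boxCluster n ω} ≤ ∑ i : Fin d, ∑ s : ℤˣ,
      ν (BondConfig.relabel (sym2Equiv (zdSignedPermIso (Equiv.swap i 0) fun _ => s).toEquiv) ⁻¹'
        halfSpaceReach d n) := by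
  obtain ⟨i, s, hsub⟩ := setOf_mem_boxCluster_subset hx
  set F : Fin d → ℤˣ → ℝ≥0∞ := fun i s =>
    ν (BondConfig.relabel (sym2Equiv (zdSignedPermIso (Equiv.swap i 0) fun _ => s).toEquiv) ⁻¹'
      halfSpaceReach d n) with hF
  have hAm : MeasurableSet (BondConfig.relabel
      (sym2Equiv (zdSignedPermIso (Equiv.swap i 0) fun _ => s).toEquiv) ⁻¹' halfSpaceReach d n) :=
    (measurableSet_halfSpaceReach n).preimage (BondConfig.relabel _).measurable
  have h1 : ν {ω | x ∈ boxCluster n ω} ≤ F i s := by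
    have h2 := hν x _ hAm
    rw [shiftPreimage_eq_relabel] at h2
    exact (measure_mono hsub).trans_eq h2
  calc ν {ω | x ∈ boxCluster n ω} ≤ F i s := h1
    _ ≤ ∑ s' : ℤˣ, F i s' :=
        Finset.single_le_sum (f := fun s' => F i s') (fun _ _ => zero_le) (Finset.mem_univ s)
    _ ≤ ∑ i' : Fin d, ∑ s' : ℤˣ, F i' s' :=
        Finset.single_le_sum (f := fun i' => ∑ s' : ℤˣ, F i' s') (fun _ _ => zero_le)
          (Finset.mem_univ i)

/-! ## The first moment of `W_n` and Markov's inequality -/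

/-- **`E_ν(W_n) ≤ |∂ⁱⁿΛ(n)| · B`** whenever `ν(x ∈ 𝒞'(Λ(n))) ≤ B` for every `x ∈ ∂ⁱⁿΛ(n)`
(Cerf–Dembin §2, (eq1), for a general law). [cite: CerfDembin2020, §2 (eq1)] -/
theorem lintegral_boundaryCount_le_of_bound (ν : Measure (BondConfig (Site d))) (n : ℕ) (B : ℝ≥0∞)
    (hB : ∀ x ∈ innerBoundary (zdGraph d) (box d n), ν {ω | x ∈ boxCluster n ω} ≤ B) :
    ∫⁻ ω, boundaryCount n ω ∂ν ≤ (innerBoundary (zdGraph d) (box d n)).card * B := by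
  have hmeas : ∀ x, MeasurableSet {ω : BondConfig (Site d) | x ∈ boxCluster n ω} := fun x => by
    rw [setOf_mem_boxCluster_eq]; exact measurableSet_openConnVia _ _ _
  unfold boundaryCount
  rw [lintegral_finsetSum _ fun x _ => measurable_one.indicator (hmeas x)]
  calc ∑ x ∈ innerBoundary (zdGraph d) (box d n),
        ∫⁻ ω, {ω' : BondConfig (Site d) | x ∈ boxCluster n ω'}.indicator 1 ω ∂ν
      = ∑ x ∈ innerBoundary (zdGraph d) (box d n), ν {ω' | x ∈ boxCluster n ω'} :=
        Finset.sum_congr rfl fun x _ => lintegral_indicator_one (hmeas x)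
    _ ≤ ∑ _x ∈ innerBoundary (zdGraph d) (box d n), B := Finset.sum_le_sum fun x hx => hB x hx
    _ = (innerBoundary (zdGraph d) (box d n)).card * B := by rw [Finset.sum_const, nsmul_eq_mul]

/-- **The bad sets are null under a vanishing first-moment bound** `E_ν(W_n) ≤ |∂ⁱⁿΛ(n)| · R_n`,
`R_n → 0`: for `n ≥ 2kN` the bad set lies in `{W_n ≥ ⌈a n^{d-1}⌉}` (`lt_card_boxCluster_inter_innerBoundary`)
and Markov gives `ν(bad) ≤ K · R_n`, `K = ⌈2d 3^{d-1}/a⌉` (Cerf–Dembin §2, (eq1)–(eq2), for a general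
law). [cite: CerfDembin2020, §2 (proof of Thm 1.2, (eq1)–(eq2))] -/
theorem measure_badSet_eq_zero_of_firstMoment (hd : 1 ≤ d) (ν : Measure (BondConfig (Site d)))
    (R : ℕ → ℝ≥0∞)
    (hW : ∀ n, ∫⁻ ω, boundaryCount n ω ∂ν ≤ (innerBoundary (zdGraph d) (box d n)).card * R n)
    (hR : Tendsto R atTop (𝓝 0)) {c : ℝ} (hc : 0 < c) (N : ℕ) :
    ν (badSet d c N) = 0 := by
  -- reduce to `N ≥ 2`
  suffices h : ∀ N, 2 ≤ N → ν (badSet d c N) = 0 by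
    exact measure_mono_null (badSet_mono le_rfl (le_max_left N 2)) (h _ (le_max_right N 2))
  intro N hN
  obtain ⟨e, rfl⟩ : ∃ e, d = e + 1 := ⟨d - 1, by omega⟩
  -- the constants `k`, `a`, `K`
  set k : ℕ := ⌈(2 : ℝ) ^ (e + 1 + 1) * ((e + 1 : ℕ) : ℝ) / c⌉₊ + 1 with hk
  have hk1 : 1 ≤ k := by omega
  have hkc : (2 : ℝ) ^ (e + 1 + 1) * ((e + 1 : ℕ) : ℝ) ≤ c * k := by
    have h1 := Nat.le_ceil ((2 : ℝ) ^ (e + 1 + 1) * ((e + 1 : ℕ) : ℝ) / c)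
    rw [div_le_iff₀ hc] at h1
    calc (2 : ℝ) ^ (e + 1 + 1) * ((e + 1 : ℕ) : ℝ)
        ≤ (⌈(2 : ℝ) ^ (e + 1 + 1) * ((e + 1 : ℕ) : ℝ) / c⌉₊ : ℝ) * c := h1
      _ ≤ k * c := by gcongr; rw [hk]; push_cast; linarith
      _ = c * k := mul_comm _ _
  set a : ℝ := c / (3 * (2 * ((e + 1 : ℕ) : ℝ)) * (2 * k * N : ℝ) ^ (e + 1)) with ha
  have ha0 : 0 < a := by positivity
  set K : ℕ := ⌈2 * ((e + 1 : ℕ) : ℝ) * (3 : ℝ) ^ e / a⌉₊ with hK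
  have hKa : 2 * ((e + 1 : ℕ) : ℝ) * (3 : ℝ) ^ e ≤ K * a := by
    have h1 := Nat.le_ceil (2 * ((e + 1 : ℕ) : ℝ) * (3 : ℝ) ^ e / a)
    rwa [div_le_iff₀ ha0] at h1
  -- for `n ≥ 2kN`: `ν(bad) ≤ K R_n`
  have hbound : ∀ n, 2 * k * N ≤ n → ν (badSet (e + 1) c N) ≤ (K : ℝ≥0∞) * R n := by
    intro n hn
    have hn1 : 1 ≤ n := le_trans (by nlinarith) hn
    have hn0 : (0 : ℝ) < n := by exact_mod_cast hn1
    have hn1' : (1 : ℝ) ≤ n := by exact_mod_cast hn1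
    set T : ℕ := ⌈a * (n : ℝ) ^ (e + 1) / n⌉₊ with hT
    have hT0 : 0 < T := Nat.ceil_pos.2 (by positivity)
    have hTa : a * (n : ℝ) ^ (e + 1) / n ≤ T := Nat.le_ceil _
    -- the bad set lies in `{T ≤ W_n}`
    have hsub : badSet (e + 1) c N ⊆ {ω | (T : ℝ≥0∞) ≤ boundaryCount n ω} := by
      intro ω hω
      have hlt := lt_card_boxCluster_inter_innerBoundary hc hN hd hk1 hkc hω hn
      have hTle : T ≤ (boxCluster n ω ∩ innerBoundary (zdGraph (e + 1)) (box (e + 1) n)).card :=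
        Nat.ceil_le.2 hlt.le
      rw [Set.mem_setOf_eq, boundaryCount_eq_card]
      exact_mod_cast hTle
    -- `|∂ⁱⁿΛ(n)| ≤ K T`
    have hKT : (innerBoundary (zdGraph (e + 1)) (box (e + 1) n)).card ≤ K * T := by
      have h1 := card_innerBoundary_box_le (d := e + 1) n
      simp only [Nat.add_sub_cancel] at h1
      have hpow : (n : ℝ) ^ (e + 1) / n = (n : ℝ) ^ e := by
        rw [pow_succ, mul_div_assoc, div_self hn0.ne', mul_one]
      have h2 : (2 * (e + 1) * (2 * n + 1) ^ e : ℝ) ≤ K * T := by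
        calc (2 * (e + 1) * (2 * n + 1) ^ e : ℝ) ≤ 2 * (e + 1) * (3 * n) ^ e := by
              gcongr; linarith
          _ = (2 * ((e + 1 : ℕ) : ℝ) * (3 : ℝ) ^ e) * (n : ℝ) ^ e := by push_cast; ring
          _ ≤ (K * a) * (n : ℝ) ^ e := by gcongr
          _ = K * (a * (n : ℝ) ^ (e + 1) / n) := by rw [mul_div_assoc, hpow]; ring
          _ ≤ K * T := by gcongr
      have h3 : 2 * (e + 1) * (2 * n + 1) ^ e ≤ K * T := by exact_mod_cast h2
      exact h1.trans h3
    -- Markov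
    have hM := mul_meas_ge_le_lintegral₀ (μ := ν) (measurable_boundaryCount n).aemeasurable (T : ℝ≥0∞)
    have hT0' : (T : ℝ≥0∞) ≠ 0 := by exact_mod_cast hT0.ne'
    rw [← ENNReal.mul_le_mul_iff_right hT0' (ENNReal.natCast_ne_top T)]
    calc (T : ℝ≥0∞) * ν (badSet (e + 1) c N) ≤ (T : ℝ≥0∞) * ν {ω | (T : ℝ≥0∞) ≤ boundaryCount n ω} := by
          gcongr
      _ ≤ ∫⁻ ω, boundaryCount n ω ∂ν := hM
      _ ≤ (innerBoundary (zdGraph (e + 1)) (box (e + 1) n)).card * R n := hW n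
      _ ≤ ((K * T : ℕ) : ℝ≥0∞) * R n := by gcongr
      _ = (T : ℝ≥0∞) * ((K : ℝ≥0∞) * R n) := by push_cast; ring
  -- the limit
  have hlim : Tendsto (fun n => (K : ℝ≥0∞) * R n) atTop (𝓝 ((K : ℝ≥0∞) * 0)) :=
    ENNReal.Tendsto.const_mul hR (Or.inr (ENNReal.natCast_ne_top K))
  rw [mul_zero] at hlim
  exact le_antisymm (ge_of_tendsto hlim (eventually_atTop.2 ⟨2 * k * N, hbound⟩)) bot_le

/-! ## The half-space input from WEAVE -/

/-- **A.s. finiteness of the half-space cluster kills percolation via the half-space**: if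
`{y | 0 ↔ y in S}` is `ν`-a.s. finite (`0 ∈ S`), then `ν(0 ↔ ∞ via steps of ℤ^d inside S) = 0`
(the constrained cluster is contained in `{y | 0 ↔ y in S}`). [folklore] -/
theorem measure_percolatesVia_eq_zero_of_ae_finite (ν : Measure (BondConfig (Site d)))
    {S : Set (Site d)} (hS : (0 : Site d) ∈ S)
    (h : ∀ᵐ ω ∂ν, {y | ω ∈ openConnIn S 0 y}.Finite) :
    ν (percolatesVia (withinGraph (zdGraph d) S) 0) = 0 := by
  rw [ae_iff] at h
  refine measure_mono_null (fun ω hω => ?_) h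
  intro hfin
  apply hω
  refine hfin.subset fun y hy => ?_
  rw [Set.mem_setOf_eq, openConnIn_eq_openConnVia hS]
  change y ∈ openClusterIn (withinGraph ⊤ S) ω 0
  have hle : withinGraph (zdGraph d) S ≤ withinGraph ⊤ S := fun u v huv => ⟨huv.1.ne, huv.2⟩
  exact openClusterIn_mono_graph hle ω 0 hy

/-- **`ν(σ⁻¹ A_n) → 0`** for a lattice automorphism `σ` fixing `0`, as soon as the cluster of `0`
inside the half-space `σ⁻¹ ℍ` is `ν`-a.s. finite as a constrained cluster: continuity from above
along the decreasing events `σ⁻¹ A_n`, whose intersection lies in `{0 ↔ ∞ via σ⁻¹ ℍ}`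
(`iInter_halfSpaceReach_subset`, `relabel_mem_percolatesVia_iff`). This replaces Cerf–Dembin's use
of Barsky–Grimmett–Newman. [cite: CerfDembin2020, §2 (use of [BarskyGrimmettNewman])] -/
theorem tendsto_measure_preimage_halfSpaceReach [NeZero d] (ν : Measure (BondConfig (Site d)))
    [IsFiniteMeasure ν] (σ : zdGraph d ≃g zdGraph d) (hσ : σ 0 = 0)
    (h0 : ν (percolatesVia (withinGraph (zdGraph d) (σ ⁻¹' halfSpace d)) 0) = 0) :
    Tendsto (fun n => ν (BondConfig.relabel (sym2Equiv σ.toEquiv) ⁻¹' halfSpaceReach d n))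
      atTop (𝓝 0) := by
  have hK : ∀ u v, (withinGraph (zdGraph d) (halfSpace d)).Adj (σ.toEquiv u) (σ.toEquiv v) ↔
      (withinGraph (zdGraph d) (σ ⁻¹' halfSpace d)).Adj u v := fun u v => by
    simp only [withinGraph_adj, Set.mem_preimage]
    rw [show σ.toEquiv u = σ u from rfl, show σ.toEquiv v = σ v from rfl, σ.map_adj_iff]
  have hlim := tendsto_measure_iInter_atTop (μ := ν)
    (fun n => ((measurableSet_halfSpaceReach (d := d) n).preimage
      (BondConfig.relabel (sym2Equiv σ.toEquiv)).measurable).nullMeasurableSet)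
    (fun m n hmn => Set.preimage_mono (antitone_halfSpaceReach hmn)) ⟨0, measure_ne_top _ _⟩
  have hsub : ⋂ n, BondConfig.relabel (sym2Equiv σ.toEquiv) ⁻¹' halfSpaceReach d n ⊆
      percolatesVia (withinGraph (zdGraph d) (σ ⁻¹' halfSpace d)) 0 := by
    rw [← Set.preimage_iInter]
    intro ω hω
    have h1 : BondConfig.relabel (sym2Equiv σ.toEquiv) ω ∈
        percolatesVia (withinGraph (zdGraph d) (halfSpace d)) 0 := iInter_halfSpaceReach_subset hω
    have h2 := relabel_mem_percolatesVia_iff σ.toEquiv hK ω 0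
    rw [show σ.toEquiv 0 = σ 0 from rfl, hσ] at h2
    exact h2.1 h1
  rwa [measure_mono_null hsub h0] at hlim

/-- The half-space `σ_{i,s}⁻¹ ℍ = {z | 0 ≤ s z_i}` for the signed permutation exchanging the axes `i`
and `0` with constant sign `s`. [folklore] -/
theorem signedPerm_preimage_halfSpace [NeZero d] (i : Fin d) (s : ℤˣ) :
    ((zdSignedPermIso (Equiv.swap i 0) fun _ => s) ⁻¹' halfSpace d : Set (Site d)) =
      {z | 0 ≤ (s : ℤ) * z i} := by
  ext z
  simp only [Set.mem_preimage, halfSpace, Set.mem_setOf_eq, zdSignedPermIso_apply,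
    Site.signedPerm_apply, Equiv.symm_swap, Equiv.swap_apply_right]

/-- **WEAVE ⇒ the `2d` half-space terms vanish in the limit**: if for every axis `i` the clusters of
`0` inside `{0 ≤ z_i}` and inside `{z_i ≤ 0}` are `ν`-a.s. finite, then
`Σ_{i,s} ν(σ_{i,s}⁻¹ A_n) → 0`. [folklore] -/
theorem tendsto_sum_measure_preimage_halfSpaceReach [NeZero d] (ν : Measure (BondConfig (Site d)))
    [IsFiniteMeasure ν]
    (hfin : ∀ i : Fin d, (∀ᵐ ω ∂ν, {y | ω ∈ openConnIn {z : Site d | 0 ≤ z i} 0 y}.Finite) ∧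
      (∀ᵐ ω ∂ν, {y | ω ∈ openConnIn {z : Site d | z i ≤ 0} 0 y}.Finite)) :
    Tendsto (fun n => ∑ i : Fin d, ∑ s : ℤˣ,
      ν (BondConfig.relabel (sym2Equiv (zdSignedPermIso (Equiv.swap i 0) fun _ => s).toEquiv) ⁻¹'
        halfSpaceReach d n)) atTop (𝓝 0) := by
  have h : ∀ (i : Fin d) (s : ℤˣ), Tendsto (fun n =>
      ν (BondConfig.relabel (sym2Equiv (zdSignedPermIso (Equiv.swap i 0) fun _ => s).toEquiv) ⁻¹'
        halfSpaceReach d n)) atTop (𝓝 0) := by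
    intro i s
    refine tendsto_measure_preimage_halfSpaceReach ν (zdSignedPermIso (Equiv.swap i 0) fun _ => s)
      (Site.signedPerm_zero _ _) ?_
    rw [signedPerm_preimage_halfSpace]
    rcases Int.units_eq_one_or s with rfl | rfl
    · have hset : {z : Site d | 0 ≤ ((1 : ℤˣ) : ℤ) * z i} = {z | 0 ≤ z i} := by
        ext z; simp
      rw [hset]
      exact measure_percolatesVia_eq_zero_of_ae_finite ν (by simp) (hfin i).1
    · have hset : {z : Site d | 0 ≤ ((-1 : ℤˣ) : ℤ) * z i} = {z | z i ≤ 0} := by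
        ext z; simp
      rw [hset]
      exact measure_percolatesVia_eq_zero_of_ae_finite ν (by simp) (hfin i).2
  have h1 : ∀ i : Fin d, Tendsto (fun n => ∑ s : ℤˣ,
      ν (BondConfig.relabel (sym2Equiv (zdSignedPermIso (Equiv.swap i 0) fun _ => s).toEquiv) ⁻¹'
        halfSpaceReach d n)) atTop (𝓝 0) := fun i => by
    simpa using tendsto_finsetSum (Finset.univ : Finset ℤˣ) fun s _ => h i s
  simpa using tendsto_finsetSum (Finset.univ : Finset (Fin d)) fun i _ => h1 i

/-! ## Assembly -/

/-- **Generalised Cerf–Dembin, dimension `d`.** For a probability measure `ν` on bond configurations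
of `ℤ^d` invariant under the translations `ξ ↦ {e | e + a ∈ ξ}` and such that for every axis `i` the
clusters of `0` inside `{0 ≤ z_i}` and `{z_i ≤ 0}` are a.s. finite: `ν`-a.s., for every `c > 0` and
`N` there are `n ≥ N` and a valid `H` with `|H| ≤ n^d` and `n |∂_{C(0)} H| ≤ c |H|`.
[cite: CerfDembin2020, Thm 1.2 (proof, §2)] -/
theorem ae_exists_validSubgraph_of_stationary [NeZero d] (hd : 1 ≤ d)
    (ν : Measure (BondConfig (Site d))) [IsProbabilityMeasure ν]
    (hν : ∀ (a : Site d) (A : Set (BondConfig (Site d))), MeasurableSet A →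
      ν ((fun ξ => Sym2.map (· + a) ⁻¹' ξ) ⁻¹' A) = ν A)
    (hfin : ∀ i : Fin d, (∀ᵐ ω ∂ν, {y | ω ∈ openConnIn {z : Site d | 0 ≤ z i} 0 y}.Finite) ∧
      (∀ᵐ ω ∂ν, {y | ω ∈ openConnIn {z : Site d | z i ≤ 0} 0 y}.Finite)) :
    ∀ᵐ ω ∂ν, ∀ c : ℝ, 0 < c → ∀ N : ℕ, ∃ n : ℕ, N ≤ n ∧ ∃ H : Finset (Site d),
      IsValidSubgraph d ω H ∧ H.card ≤ n ^ d ∧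
        (n : ℝ) * (openEdgeBoundaryCard d ω H : ℝ) ≤ c * H.card := by
  set R : ℕ → ℝ≥0∞ := fun n => ∑ i : Fin d, ∑ s : ℤˣ,
    ν (BondConfig.relabel (sym2Equiv (zdSignedPermIso (Equiv.swap i 0) fun _ => s).toEquiv) ⁻¹'
      halfSpaceReach d n) with hR
  have hW : ∀ n, ∫⁻ ω, boundaryCount n ω ∂ν ≤ (innerBoundary (zdGraph d) (box d n)).card * R n :=
    fun n => lintegral_boundaryCount_le_of_bound ν n (R n)
      fun x hx => measure_setOf_mem_boxCluster_le ν hν hx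
  have hRlim : Tendsto R atTop (𝓝 0) := tendsto_sum_measure_preimage_halfSpaceReach ν hfin
  have h : ∀ m N : ℕ, ∀ᵐ ω ∂ν, ω ∉ badSet d (1 / ((m : ℝ) + 1)) N := by
    intro m N
    rw [ae_iff]
    simp only [not_not, Set.setOf_mem_eq]
    exact measure_badSet_eq_zero_of_firstMoment hd ν R hW hRlim (by positivity) N
  have h' : ∀ᵐ ω ∂ν, ∀ m N : ℕ, ω ∉ badSet d (1 / ((m : ℝ) + 1)) N :=
    ae_all_iff.2 fun m => ae_all_iff.2 (h m)
  filter_upwards [h'] with ω hω c hc N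
  obtain ⟨m, hm⟩ := exists_nat_one_div_lt hc
  have hωm := hω m N
  simp only [badSet, Set.mem_setOf_eq, not_forall, not_lt, exists_prop] at hωm
  obtain ⟨n, hn, H, hH, hcard, hle⟩ := hωm
  exact ⟨n, hn, H, hH, hcard, hle.trans (mul_le_mul_of_nonneg_right hm.le (by positivity))⟩

end StationaryWeaving

/-- **Item `stmt-CriticalPhenomena-5262` (`PercThresholdOne.StationaryWeavingVanishingProfile`),
proved: the generalised Cerf–Dembin theorem on `ℤ³`.** For every translation-invariant probability
measure `ν` on bond configurations of `ℤ³`, a.s. supported on nearest-neighbour edges and a.s. weaving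
(all half-space clusters finite), `ν`-a.s. for every `c > 0` and `N` there are `n ≥ N` and a finite
`K ∋ 0`, joined to `0` inside `K` by open paths, with `|K| ≤ n³` and `n |∂°K| ≤ c |K|`. The proof is
Cerf–Dembin's (arXiv:1903.08065, §2) with the half-space input supplied by WEAVE and the lattice
symmetry of `P_p` replaced by translation invariance alone (`StationaryWeaving.*` above); the support
hypothesis is not needed. [cite: CerfDembin2020, Thm 1.2 (proof, §2)] -/
theorem stationaryWeavingVanishingProfile_proof :
    Summit.CriticalPhenomena.PercolationContinuityZ3.Theses.PercThresholdOne.StationaryWeavingVanishingProfile := by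
  unfold Summit.CriticalPhenomena.PercolationContinuityZ3.Theses.PercThresholdOne.StationaryWeavingVanishingProfile
  intro ν hprob hν hae
  haveI : MeasureTheory.IsProbabilityMeasure ν := hprob
  have hfin : ∀ i : Fin 3,
      (∀ᵐ ω ∂ν, {y | ω ∈ Literature.Probability.Percolation.openConnIn
        {z : Literature.Probability.LatticeModels.Site 3 | 0 ≤ z i} 0 y}.Finite) ∧
      (∀ᵐ ω ∂ν, {y | ω ∈ Literature.Probability.Percolation.openConnIn
        {z : Literature.Probability.LatticeModels.Site 3 | z i ≤ 0} 0 y}.Finite) := by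
    intro i
    exact ⟨by filter_upwards [hae] with ω hω using (hω.2 i 0 0).1,
      by filter_upwards [hae] with ω hω using (hω.2 i 0 0).2⟩
  have h := StationaryWeaving.ae_exists_validSubgraph_of_stationary (d := 3) (by norm_num) ν hν hfin
  filter_upwards [h] with ω hω c hc N
  obtain ⟨n, hn, H, hH, hcard, hle⟩ := hω c hc N
  exact ⟨n, hn, H, hH.1, hH.2, hcard, hle⟩

end Summit.CriticalPhenomena.PercolationContinuityZ3.Theorems
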